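import Mathlib.Topology.Connected.LocallyPathConnected
import Mathlib.Topology.Algebra.Module.LocallyConvex
import Mathlib.Topology.UniformSpace.HeineCantor
import Mathlib.Topology.MetricSpace.HausdorffDistance
import Mathlib.Analysis.Complex.Convex
import Mathlib.Analysis.Complex.ReImTopology
import Mathlib.Analysis.Normed.Field.Lemmas
import Mathlib.Topology.Bornology.BoundedOperation
import Literature.Probability.RandomPlanarGeometry.HalfPlaneFill
import Literature.Topology.PlaneTopology.JordanCurve
import HarnessLib

/-!
# Anchored rational test sets of the half-plane separate points from simple paths

Half-plane topology for the transposition of [LSW] Thm. 6.1 to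
`Literature.Probability.RandomPlanarGeometry.IsSLELaw.hullRestriction_eightThirds` (plan in `ConformalRestrictionProofs`; G. F. Lawler,
O. Schramm, W. Werner, *Conformal restriction: the chordal case*, J. Amer. Math. Soc. **16**
(2003), arXiv:math/0209343). [LSW] Lemma 3.2 (p. 10) determines a law on the space `Ω` of
Def. 3.1 by the avoidance probabilities of `*`-hulls, "this σ-field being the same as the Borel
σ-field induced by the Hausdorff metric". On the curve side (`SimpleCurveLaws`), the transfer
theorem `CurveClass.Measure.ext_of_missCode_injOn` needs a COUNTABLE family of test sets whose
avoidance pattern separates the traces. This file provides the half-plane family and proves the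
separation property:

* `Literature.halfDisc c`, `Literature.testSet l` — closed rational discs cut to the closed half-plane and
  their finite unions, indexed by lists `l` of rational triples (a countable index set);
  `Literature.IsAnchored S` — `0 ∉ S` and `S ∪ {Im ≤ 0}` is connected, the condition under which the
  fill `hpFill S` is a hull (`HalfPlaneFill.isBoundedHull_hpFill`);
* `Literature.Probability.RandomPlanarGeometry.exists_anchored_testSet` — **separation**: if `K ∋ 0` is a closed subset of `ℍ ∪ {0}`
  with connected complement and `z ∈ ℍ ∖ K`, some anchored test set contains `z` and misses
  `K`. Proof: `ℂ ∖ K` is open and connected, hence path connected; follow a path from `z`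
  towards `−i` up to its first point `x` on the real axis (`x ≠ 0` as `0 ∈ K`); the initial arc
  is compact and misses `K`, hence stays at distance `δ > 0` from it; cover it by a chain of
  rational closed discs of radius `≈ δ/2` centred near consecutive points of a fine subdivision
  (uniform continuity) — the chain is connected, contains `z`, ends at the real point `x`, and
  misses `K`.

The connectedness of `ℂ ∖ K` for the sets `K` that occur — a simple path in `ℍ ∪ {0}` from `0`
to `∞`, i.e. an arc of the Riemann sphere through `∞` — is DERIVED here
(`Literature.Probability.RandomPlanarGeometry.isConnected_compl_image_of_tendsto_cocompact`) from the tree's named fact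
`Literature.Topology.PlaneTopology.JordanArcSeparation` (`Literature.Topology.PlaneTopology.JordanCurve`: a Jordan arc does not
separate the plane; McCleary 2006, Ch. 9; Newman 1939, Ch. V Thm. 10.1 "in the open or closed
plane") by an inversion `z ↦ (z − c)⁻¹` about a point `c ∉ K`, which turns `K ∪ {∞}` into a
compact Jordan arc `Λ ∋ 0` and `ℂ ∖ (K ∪ {c})` homeomorphically onto `ℂ ∖ Λ`; adding back the
point `c` of the open set `ℂ ∖ K` keeps connectedness.

Mathlib: `IsOpen.isConnected_iff_isPathConnected` (locally path-connected `ℂ`), `JoinedIn`,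
`IsCompact.uniformContinuousOn_of_continuous`, `Metric.infDist`,
`IsPreconnected.biUnion_of_chain`, `Convex.isPreconnected`, `exists_rat_btwn`.
-/

noncomputable section

open Set Filter Topology Metric Complex
open UpperHalfPlane (upperHalfPlaneSet isOpen_upperHalfPlaneSet)
open scoped NNReal

namespace Literature.Probability.RandomPlanarGeometry

/-! ### An arc through `∞` does not separate the plane (from `JordanArcSeparation`) -/

section Ray

variable {β : ℝ → ℂ}

/-- The trace of a path `β : [0, 1) → ℂ` running to infinity is closed. [folklore] -/
theorem isClosed_image_of_tendsto_cocompact (hβc : ContinuousOn β (Ico 0 1))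
    (hβ : Tendsto β (𝓝[<] 1) (cocompact ℂ)) : IsClosed (β '' Ico 0 1) := by
  refine isClosed_of_closure_subset fun k hk ↦ ?_
  -- far out in parameter, `β` leaves the closed ball of radius `‖k‖ + 1`
  have hev : ∀ᶠ t in 𝓝[<] (1 : ℝ), β t ∈ (closedBall (0 : ℂ) (‖k‖ + 1))ᶜ :=
    hβ (isCompact_closedBall 0 _).compl_mem_cocompact
  obtain ⟨a, ha1, ha⟩ : ∃ a < (1 : ℝ), ∀ t ∈ Ioo a 1, β t ∈ (closedBall (0 : ℂ) (‖k‖ + 1))ᶜ := by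
    rcases (mem_nhdsLT_iff_exists_Ioo_subset).1 hev with ⟨a, ha1, ha⟩
    exact ⟨a, ha1, fun t ht ↦ ha ht⟩
  -- so near `k` the trace comes from the compact parameter set `[0, max a 0]`
  set a' := max a 0 with ha'
  have hsub : β '' Ico 0 1 ∩ ball k 1 ⊆ β '' Icc 0 a' := by
    rintro _ ⟨⟨t, ht, rfl⟩, hball⟩
    refine ⟨t, ⟨ht.1, ?_⟩, rfl⟩
    by_contra hta
    push Not at hta
    have hta' : t ∈ Ioo a 1 := ⟨(le_max_left a 0).trans_lt hta, ht.2⟩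
    have h1 := ha t hta'
    rw [mem_compl_iff, mem_closedBall, dist_zero_right, not_le] at h1
    rw [mem_ball, dist_eq_norm] at hball
    have : ‖β t‖ ≤ ‖β t - k‖ + ‖k‖ := norm_le_norm_sub_add _ _
    linarith
  have hcpt : IsCompact (β '' Icc 0 a') :=
    isCompact_Icc.image_of_continuousOn (hβc.mono fun t ht ↦ ⟨ht.1, ht.2.trans_lt (max_lt ha1 one_pos)⟩)
  have hk' : k ∈ closure (β '' Ico 0 1 ∩ ball k 1) := by
    rw [mem_closure_iff_nhds] at hk ⊢
    intro U hU
    obtain ⟨w, hwU, hw⟩ := hk (U ∩ ball k 1) (inter_mem hU (ball_mem_nhds k one_pos))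
    exact ⟨w, hwU.1, hw, hwU.2⟩
  have hk'' : k ∈ β '' Icc 0 a' := hcpt.isClosed.closure_subset (closure_mono hsub hk')
  obtain ⟨t, ht, rfl⟩ := hk''
  exact ⟨t, ⟨ht.1, ht.2.trans_lt (max_lt ha1 one_pos)⟩, rfl⟩

/-- **The complement of a simple path running to infinity is connected**, from the tree's named
fact `JordanArcSeparation` (a Jordan arc does not separate the plane): if `β : [0, 1) → ℂ` is
continuous, injective, `β(t) → ∞` as `t → 1`, and `c ∉ K = β[0, 1)`, then `ℂ ∖ K` is connected.
The inversion `ι(z) = (z − c)⁻¹` maps `K ∪ {∞}` onto the compact Jordan arc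
`Λ = ι(K) ∪ {0}` (parametrised by `[0, 1]`, `1 ↦ 0`) and `ℂ ∖ (K ∪ {c})` homeomorphically onto
`ℂ ∖ Λ`, which is connected; and `c` lies in the closure of the open set `ℂ ∖ (K ∪ {c})`.
(Newman 1939, Ch. V Thm. 10.1 states the theorem directly "in the open or closed plane".)
[cite: Mccleary2006, Ch. 9, p. 130 (Separation Theorem for Jordan arcs)] -/
theorem isConnected_compl_image_of_tendsto_cocompact (hJ : Literature.Topology.PlaneTopology.JordanArcSeparation)
    (hβc : ContinuousOn β (Ico 0 1)) (hβi : InjOn β (Ico 0 1))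
    (hβ : Tendsto β (𝓝[<] 1) (cocompact ℂ)) {c : ℂ} (hc : c ∉ β '' Ico 0 1) :
    IsConnected (β '' Ico 0 1)ᶜ := by
  classical
  set K := β '' Ico 0 1 with hK
  have hKcl : IsClosed K := isClosed_image_of_tendsto_cocompact hβc hβ
  -- the inversion
  set ι : ℂ → ℂ := fun z ↦ (z - c)⁻¹ with hι
  have hβne : ∀ t ∈ Ico (0 : ℝ) 1, β t - c ≠ 0 := fun t ht h ↦ hc ⟨t, ht, sub_eq_zero.1 h⟩
  have hιinj : ∀ {z w : ℂ}, ι z = ι w → z = w := fun h ↦ sub_left_injective (inv_inj.1 h)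
  -- the map `g₁ : ℝ → ℂ`, `x ↦ ι (β x)` for `x < 1`, `0` from `1` on, continuous on `[0, 1]`
  set g₁ : ℝ → ℂ := fun x ↦ if x < 1 then ι (β x) else 0 with hg₁
  have hg₁_lt : ∀ {x : ℝ}, x < 1 → g₁ x = ι (β x) := fun hx ↦ if_pos hx
  have hg₁_one : g₁ 1 = 0 := if_neg (lt_irrefl _)
  have hιβ : ContinuousOn (fun t : ℝ ↦ ι (β t)) (Ico 0 1) :=
    ContinuousOn.inv₀ (hβc.sub continuousOn_const) hβne
  have hι0 : Tendsto (fun t : ℝ ↦ ι (β t)) (𝓝[<] 1) (𝓝 0) := by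
    have h1 : Tendsto (fun t ↦ β t - c) (𝓝[<] 1) (Bornology.cobounded ℂ) := by
      rw [← Metric.cobounded_eq_cocompact] at hβ
      exact (tendsto_sub_const_cobounded c).comp hβ
    exact Filter.tendsto_inv₀_cobounded.comp h1
  have hg₁c : ContinuousOn g₁ (Icc 0 1) := by
    intro x hx
    rcases hx.2.lt_or_eq with hx1 | rfl
    · -- `x < 1`: locally `g₁ = ι ∘ β`
      have hmem : Ico (0 : ℝ) 1 ∈ 𝓝[Icc 0 1] x := by
        have : Ico (0 : ℝ) 1 = Icc 0 1 ∩ Iio 1 := by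
          ext y; simp only [mem_Ico, mem_inter_iff, mem_Icc, mem_Iio]
          exact ⟨fun h ↦ ⟨⟨h.1, h.2.le⟩, h.2⟩, fun h ↦ ⟨h.1.1, h.2⟩⟩
        rw [this]
        exact inter_mem_nhdsWithin _ (Iio_mem_nhds hx1)
      have h1 : ContinuousWithinAt (fun t : ℝ ↦ ι (β t)) (Icc 0 1) x :=
        (hιβ x ⟨hx.1, hx1⟩).mono_of_mem_nhdsWithin hmem
      refine h1.congr_of_eventuallyEq ?_ (hg₁_lt hx1)
      filter_upwards [hmem] with y hy using hg₁_lt hy.2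
    · -- at `1`: `ι (β t) → 0 = g₁ 1`
      change Tendsto g₁ (𝓝[Icc 0 1] 1) (𝓝 (g₁ 1))
      rw [hg₁_one]
      have hle : 𝓝[Icc (0 : ℝ) 1] 1 ≤ 𝓝[Iio 1 ∪ {1}] 1 := nhdsWithin_mono _ fun y hy ↦ by
        rcases hy.2.lt_or_eq with h | h
        · exact Or.inl h
        · exact Or.inr h
      refine Tendsto.mono_left ?_ hle
      rw [nhdsWithin_union, nhdsWithin_singleton]
      refine tendsto_sup.2 ⟨hι0.congr' ?_, ?_⟩
      · filter_upwards [self_mem_nhdsWithin] with y hy using (hg₁_lt hy).symm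
      · rw [← hg₁_one]
        exact tendsto_pure_nhds g₁ 1
  -- the compact arc `Λ = g₁ [0, 1]`, injectively parametrised
  set lam : unitInterval → ℂ := fun t ↦ g₁ t with hlam
  have hlamc : Continuous lam := hg₁c.comp_continuous continuous_subtype_val fun t ↦ t.2
  have hlam_val : ∀ t : unitInterval, (t : ℝ) < 1 → lam t = ι (β t) := fun t ht ↦ hg₁_lt ht
  have hlam_top : ∀ t : unitInterval, ¬ (t : ℝ) < 1 → lam t = 0 := fun t ht ↦ by
    have : (t : ℝ) = 1 := le_antisymm t.2.2 (not_lt.1 ht)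
    change g₁ t = 0
    rw [this, hg₁_one]
  have hιne : ∀ t : unitInterval, (t : ℝ) < 1 → ι (β t) ≠ 0 := fun t ht ↦
    inv_ne_zero (hβne t ⟨t.2.1, ht⟩)
  have hinj : Function.Injective lam := by
    intro s t hst
    by_cases hs : (s : ℝ) < 1 <;> by_cases ht : (t : ℝ) < 1
    · rw [hlam_val s hs, hlam_val t ht] at hst
      exact Subtype.ext (hβi ⟨s.2.1, hs⟩ ⟨t.2.1, ht⟩ (hιinj hst))
    · rw [hlam_val s hs, hlam_top t ht] at hst
      exact absurd hst (hιne s hs)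
    · rw [hlam_top s hs, hlam_val t ht] at hst
      exact absurd hst.symm (hιne t ht)
    · exact Subtype.ext ((le_antisymm s.2.2 (not_lt.1 hs)).trans
        (le_antisymm t.2.2 (not_lt.1 ht)).symm)
  have hΛ : IsConnected (range lam)ᶜ := by
    refine hJ (range lam) ⟨?_⟩
    exact Continuous.homeoOfEquivCompactToT2 (f := Equiv.ofInjective lam hinj)
      (continuous_induced_rng.2 hlamc)
  -- `z ↦ ι z` identifies `ℂ ∖ (K ∪ {c})` with `ℂ ∖ Λ`
  have hzero : (0 : ℂ) ∈ range lam := ⟨1, hlam_top 1 (by norm_num)⟩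
  have hkey : ∀ {z : ℂ}, z ≠ c → (z ∉ K ↔ ι z ∉ range lam) := by
    intro z hzc
    have hιz : ι z ≠ 0 := inv_ne_zero (sub_ne_zero.2 hzc)
    constructor
    · rintro hzK ⟨t, ht⟩
      by_cases ht1 : (t : ℝ) < 1
      · rw [hlam_val t ht1] at ht
        exact hzK ⟨t, ⟨t.2.1, ht1⟩, hιinj ht⟩
      · rw [hlam_top t ht1] at ht
        exact hιz ht.symm
    · rintro hι ⟨t, ht, rfl⟩
      exact hι ⟨⟨t, ht.1, ht.2.le⟩, hlam_val _ ht.2⟩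
  have himage : (fun w ↦ w⁻¹ + c) '' (range lam)ᶜ = Kᶜ \ {c} := by
    ext z
    constructor
    · rintro ⟨w, hw, rfl⟩
      have hw0 : w ≠ 0 := fun h ↦ hw (h ▸ hzero)
      have hzc : w⁻¹ + c ≠ c := by simpa using inv_ne_zero hw0
      have hιz : ι (w⁻¹ + c) = w := by simp [hι]
      exact ⟨(hkey hzc).2 (hιz.symm ▸ hw), hzc⟩
    · rintro ⟨hzK, hzc⟩
      refine ⟨ι z, (hkey hzc).1 hzK, ?_⟩
      simp [hι]
  have hconn : IsConnected (Kᶜ \ {c}) := by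
    rw [← himage]
    refine hΛ.image _ ((continuousOn_inv₀.mono ?_).add continuousOn_const)
    intro w hw h0
    exact hw ((show w = 0 from h0) ▸ hzero)
  -- put back the point `c`
  refine ⟨⟨c, hc⟩, hconn.isPreconnected.subset_closure sdiff_subset ?_⟩
  intro z hz
  by_cases hzc : z = c
  · subst hzc
    rw [mem_closure_iff_nhds]
    intro U hU
    have h1 : {z}ᶜ ∩ (U ∩ Kᶜ) ∈ 𝓝[≠] z :=
      inter_mem_nhdsWithin _ (inter_mem hU (hKcl.isOpen_compl.mem_nhds hz))
    obtain ⟨w, hwz, hwU, hwK⟩ := Filter.nonempty_of_mem h1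
    exact ⟨w, hwU, hwK, hwz⟩
  · exact subset_closure ⟨hz, hzc⟩

end Ray

/-! ### Rational half-discs and test sets -/

/-- The closed rational disc `closedBall (p + q i) r` cut to the closed upper half-plane, for a
rational triple `c = (p, q, r)`. [folklore] -/
def halfDisc (c : ℚ × ℚ × ℚ) : Set ℂ :=
  closedBall (⟨(c.1 : ℝ), (c.2.1 : ℝ)⟩ : ℂ) c.2.2 ∩ {z : ℂ | 0 ≤ z.im}

/-- The **test set** of a list of rational triples: the finite union of its half-discs. The
lists form a countable index set. [folklore] -/
def testSet (l : List (ℚ × ℚ × ℚ)) : Set ℂ := ⋃ c ∈ l, halfDisc c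

/-- `S` is **anchored**: `0 ∉ S` and `S ∪ {Im ≤ 0}` is connected (so that `hpFill S` is a hull,
`isBoundedHull_hpFill`, and a `*`-hull as soon as `0 ∉ hpFill S`). [folklore] -/
def IsAnchored (S : Set ℂ) : Prop :=
  (0 : ℂ) ∉ S ∧ IsConnected (S ∪ {z : ℂ | z.im ≤ 0})

/-- Half-discs are closed. [folklore] -/
theorem isClosed_halfDisc (c : ℚ × ℚ × ℚ) : IsClosed (halfDisc c) :=
  isClosed_closedBall.inter (isClosed_le continuous_const Complex.continuous_im)

/-- Half-discs are bounded. [folklore] -/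
theorem isBounded_halfDisc (c : ℚ × ℚ × ℚ) : Bornology.IsBounded (halfDisc c) :=
  isBounded_closedBall.subset inter_subset_left

/-- Half-discs lie in the closed upper half-plane. [folklore] -/
theorem halfDisc_subset_closure (c : ℚ × ℚ × ℚ) : halfDisc c ⊆ closure upperHalfPlaneSet := by
  rw [show closure upperHalfPlaneSet = {z : ℂ | 0 ≤ z.im} from Complex.closure_setOf_lt_im 0]
  exact inter_subset_right

/-- Test sets are closed. [folklore] -/
theorem isClosed_testSet (l : List (ℚ × ℚ × ℚ)) : IsClosed (testSet l) :=
  l.finite_toSet.isClosed_biUnion fun c _ ↦ isClosed_halfDisc c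

/-- Test sets are bounded. [folklore] -/
theorem isBounded_testSet (l : List (ℚ × ℚ × ℚ)) : Bornology.IsBounded (testSet l) :=
  Bornology.isBounded_biUnion l.finite_toSet |>.2 fun c _ ↦ isBounded_halfDisc c

/-- Test sets are compact. [folklore] -/
theorem isCompact_testSet (l : List (ℚ × ℚ × ℚ)) : IsCompact (testSet l) :=
  Metric.isCompact_of_isClosed_isBounded (isClosed_testSet l) (isBounded_testSet l)

/-- Test sets lie in the closed upper half-plane. [folklore] -/
theorem testSet_subset_closure (l : List (ℚ × ℚ × ℚ)) : testSet l ⊆ closure upperHalfPlaneSet :=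
  iUnion₂_subset fun c _ ↦ halfDisc_subset_closure c

/-- The test set of a concatenation is the union. [folklore] -/
theorem testSet_append (l l' : List (ℚ × ℚ × ℚ)) : testSet (l ++ l') = testSet l ∪ testSet l' := by
  simp only [testSet, List.mem_append]
  ext z
  simp only [mem_iUnion, mem_union, exists_prop]
  constructor
  · rintro ⟨c, hc | hc, hz⟩
    · exact Or.inl ⟨c, hc, hz⟩
    · exact Or.inr ⟨c, hc, hz⟩
  · rintro (⟨c, hc, hz⟩ | ⟨c, hc, hz⟩)
    · exact ⟨c, Or.inl hc, hz⟩
    · exact ⟨c, Or.inr hc, hz⟩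

/-- The empty list gives the empty test set. [folklore] -/
@[simp] theorem testSet_nil : testSet [] = ∅ := by simp [testSet]

/-- Anchored sets are closed under union. [folklore] -/
theorem IsAnchored.union {S T : Set ℂ} (hS : IsAnchored S) (hT : IsAnchored T) :
    IsAnchored (S ∪ T) := by
  refine ⟨fun h ↦ h.elim hS.1 hT.1, ?_⟩
  have h : S ∪ T ∪ {z : ℂ | z.im ≤ 0} = (S ∪ {z : ℂ | z.im ≤ 0}) ∪ (T ∪ {z : ℂ | z.im ≤ 0}) := by
    ext z; simp only [mem_union, mem_setOf_eq]; tauto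
  rw [h]
  refine hS.2.union ⟨-I, ?_, ?_⟩ hT.2 <;> exact Or.inr (by simp)

/-! ### From a point of `ℍ ∖ K` to the real axis inside `ℂ ∖ K` -/

section Path

variable {K : Set ℂ} {z : ℂ}

/-- **First exit to the real axis.** If `ℂ ∖ K` is open and connected, `K ⊆ ℍ ∪ {0}`, and
`z ∈ ℍ ∖ K`, there is a continuous `g : ℝ → ℂ` and `τ > 0` with `g 0 = z`, `g τ` real,
`g t ∈ ℍ` for `t ∈ [0, τ)` and `g[0, τ] ∩ K = ∅`: follow a path from `z` to `−i` in `ℂ ∖ K`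
(open connected sets of `ℂ` are path connected) up to the first parameter where it reaches
`{Im ≤ 0}`. [folklore] -/
theorem exists_path_to_real (hK : IsClosed K) (hKc : IsConnected Kᶜ)
    (hKsub : K ⊆ upperHalfPlaneSet ∪ {0}) (hz : z ∈ upperHalfPlaneSet) (hzK : z ∉ K) :
    ∃ g : ℝ → ℂ, Continuous g ∧ ∃ τ : ℝ, 0 < τ ∧ g 0 = z ∧ (g τ).im = 0 ∧
      (∀ t ∈ Ico 0 τ, 0 < (g t).im) ∧ ∀ t ∈ Icc 0 τ, g t ∉ K := by
  have hz0 : 0 < z.im := hz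
  -- a path from `z` to `-I` in `ℂ ∖ K`
  have hpc : IsPathConnected Kᶜ := (hK.isOpen_compl.isConnected_iff_isPathConnected).1 hKc
  have hw : -I ∈ Kᶜ := by
    intro h
    rcases hKsub h with h1 | h1
    · exact absurd (show (0 : ℝ) < (-I).im from h1) (by simp)
    · simp at h1
  obtain ⟨γ, hγK⟩ : JoinedIn Kᶜ z (-I) := hpc.joinedIn z hzK (-I) hw
  set f : ℝ → ℂ := fun t ↦ γ (projIcc 0 1 zero_le_one t) with hf
  have hfc : Continuous f := γ.continuous.comp continuous_projIcc
  have hf0 : f 0 = z := by simp [hf]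
  have hf1 : f 1 = -I := by simp [hf]
  have hfK : ∀ t, f t ∉ K := fun t ↦ hγK _
  -- the first parameter with `Im ≤ 0`
  set T : Set ℝ := {t | t ∈ Icc (0 : ℝ) 1 ∧ (f t).im ≤ 0} with hT
  have hTclosed : IsClosed T :=
    isClosed_Icc.inter (isClosed_le (Complex.continuous_im.comp hfc) continuous_const)
  have h1T : (1 : ℝ) ∈ T := ⟨⟨zero_le_one, le_rfl⟩, by rw [hf1]; simp⟩
  have hTne : T.Nonempty := ⟨1, h1T⟩
  have hTbdd : BddBelow T := ⟨0, fun t ht ↦ ht.1.1⟩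
  set τ := sInf T with hτ
  have hτT : τ ∈ T := hTclosed.csInf_mem hTne hTbdd
  have hτ1 : τ ≤ 1 := csInf_le hTbdd h1T
  have hlt : ∀ t ∈ Ico 0 τ, 0 < (f t).im := by
    intro t ht
    by_contra hle
    push Not at hle
    have htT : t ∈ T := ⟨⟨ht.1, ht.2.le.trans hτ1⟩, hle⟩
    exact absurd (csInf_le hTbdd htT) (not_le.2 ht.2)
  have hτ0 : 0 < τ := by
    rcases hτT.1.1.lt_or_eq with h | h
    · exact h
    · exfalso
      have := hτT.2
      rw [← h, hf0] at this
      exact absurd hz0 (not_lt.2 this)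
  refine ⟨f, hfc, τ, hτ0, hf0, le_antisymm hτT.2 ?_, hlt, fun t _ ↦ hfK t⟩
  -- `Im (f τ) ≥ 0` as a limit from the left of positive values
  have htend : Tendsto (fun t ↦ (f t).im) (𝓝[<] τ) (𝓝 (f τ).im) :=
    ((Complex.continuous_im.comp hfc).tendsto τ).mono_left nhdsWithin_le_nhds
  refine ge_of_tendsto htend ?_
  filter_upwards [Ioo_mem_nhdsLT hτ0] with t ht
  exact (hlt t ⟨ht.1.le, ht.2⟩).le

end Path

/-! ### The disc chain -/

section Chain

/-- A rational point within `ε` of a complex number. [folklore] -/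
theorem exists_rat_near (w : ℂ) {ε : ℝ} (hε : 0 < ε) :
    ∃ q : ℚ × ℚ, dist (⟨(q.1 : ℝ), (q.2 : ℝ)⟩ : ℂ) w < ε := by
  obtain ⟨q₁, hq₁, hq₁'⟩ := exists_rat_btwn (show w.re - ε / 2 < w.re + ε / 2 by linarith)
  obtain ⟨q₂, hq₂, hq₂'⟩ := exists_rat_btwn (show w.im - ε / 2 < w.im + ε / 2 by linarith)
  refine ⟨(q₁, q₂), ?_⟩
  rw [Complex.dist_eq]
  have hre : |(q₁ : ℝ) - w.re| < ε / 2 := abs_sub_lt_iff.2 ⟨by linarith, by linarith⟩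
  have him : |(q₂ : ℝ) - w.im| < ε / 2 := abs_sub_lt_iff.2 ⟨by linarith, by linarith⟩
  calc ‖(⟨(q₁ : ℝ), (q₂ : ℝ)⟩ : ℂ) - w‖
      ≤ |((⟨(q₁ : ℝ), (q₂ : ℝ)⟩ : ℂ) - w).re| + |((⟨(q₁ : ℝ), (q₂ : ℝ)⟩ : ℂ) - w).im| :=
        Complex.norm_le_abs_re_add_abs_im _
    _ < ε / 2 + ε / 2 := by
        gcongr
        · simpa using hre
        · simpa using him
    _ = ε := by ring

variable {K : Set ℂ} {g : ℝ → ℂ} {τ : ℝ}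

/-- A compact arc missing the closed set `K ∋ 0` stays at positive distance from it. [folklore] -/
theorem exists_dist_le (hK : IsClosed K) (h0K : (0 : ℂ) ∈ K) (hg : Continuous g)
    (hgK : ∀ t ∈ Icc 0 τ, g t ∉ K) :
    ∃ δ : ℝ, 0 < δ ∧ ∀ t ∈ Icc 0 τ, ∀ k ∈ K, δ ≤ dist (g t) k := by
  rcases (Icc (0 : ℝ) τ).eq_empty_or_nonempty with he | hne
  · exact ⟨1, one_pos, fun t ht ↦ by simp [he] at ht⟩
  have hΓ : IsCompact (g '' Icc 0 τ) := isCompact_Icc.image hg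
  obtain ⟨y₀, ⟨t₀, ht₀, rfl⟩, hmin⟩ :=
    hΓ.exists_isMinOn (hne.image g) (continuous_infDist_pt K).continuousOn
  refine ⟨infDist (g t₀) K, (infDist_pos_iff_notMem_closure ⟨0, h0K⟩).1 ?_, fun t ht k hk ↦ ?_⟩
  · rw [hK.closure_eq]
    exact hgK t₀ ht₀
  · exact (hmin ⟨t, ht, rfl⟩).trans (infDist_le_dist_of_mem hk)

/-- **The disc chain.** Given a continuous `g` on `[0, τ]` (`τ > 0`) with `g[0,τ]` at distance
`≥ δ > 0` from `K`, there is a list of rational discs of a common radius `r ∈ (δ/2, 3δ/4)`,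
centred within `δ/8` of the points `g(jτ/m)` of a subdivision finer than the `δ/4`-modulus of
uniform continuity, such that: `g 0` is in the first disc, `g τ` in the last, consecutive discs
meet, and every disc misses `K`. [folklore] -/
theorem exists_discChain (hτ : 0 < τ) (hg : Continuous g) {δ : ℝ} (hδ : 0 < δ)
    (hdist : ∀ t ∈ Icc 0 τ, ∀ k ∈ K, δ ≤ dist (g t) k) :
    ∃ (m : ℕ) (c : ℕ → ℚ × ℚ) (r : ℚ), 0 < m ∧
      (∀ j ≤ m, g (τ * j / m) ∈ closedBall (⟨((c j).1 : ℝ), ((c j).2 : ℝ)⟩ : ℂ) r) ∧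
      (∀ j < m, g (τ * j / m) ∈ closedBall (⟨((c (j + 1)).1 : ℝ), ((c (j + 1)).2 : ℝ)⟩ : ℂ) r) ∧
      ∀ j ≤ m, Disjoint (closedBall (⟨((c j).1 : ℝ), ((c j).2 : ℝ)⟩ : ℂ) r) K := by
  -- uniform continuity on `[0, τ]`
  have huc := isCompact_Icc.uniformContinuousOn_of_continuous (hg.continuousOn (s := Icc 0 τ))
  obtain ⟨η, hη, hηuc⟩ := Metric.uniformContinuousOn_iff.1 huc (δ / 4) (by positivity)
  -- subdivision
  obtain ⟨m, hm⟩ := exists_nat_gt (τ / η)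
  have hm0 : 0 < m := by
    have : (0 : ℝ) < m := (div_pos hτ hη).trans hm
    exact_mod_cast this
  have hmR : (0 : ℝ) < m := by exact_mod_cast hm0
  have hstep : τ / m < η := by
    rw [div_lt_iff₀ hmR]
    calc τ = τ / η * η := by field_simp
      _ < m * η := by gcongr
      _ = η * m := mul_comm _ _
  have hmem : ∀ j : ℕ, j ≤ m → τ * j / m ∈ Icc 0 τ := fun j hj ↦ by
    refine ⟨by positivity, ?_⟩
    rw [div_le_iff₀ hmR]
    have : (j : ℝ) ≤ m := by exact_mod_cast hj
    nlinarith
  have hcons : ∀ j : ℕ, j < m → dist (g (τ * j / m)) (g (τ * (j + 1 : ℕ) / m)) < δ / 4 := by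
    intro j hj
    refine hηuc _ (hmem j hj.le) _ (hmem (j + 1) hj) ?_
    rw [Real.dist_eq, show τ * j / m - τ * (j + 1 : ℕ) / m = -(τ / m) by push_cast; ring,
      abs_neg, abs_of_pos (div_pos hτ hmR)]
    exact hstep
  -- rational centres and radius
  choose c hc using fun j : ℕ ↦ exists_rat_near (g (τ * j / m)) (show 0 < δ / 8 by positivity)
  obtain ⟨r, hr, hr'⟩ := exists_rat_btwn (show δ / 2 < 3 * δ / 4 by linarith)
  refine ⟨m, c, r, hm0, fun j _ ↦ ?_, fun j hj ↦ ?_, fun j _ ↦ ?_⟩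
  · rw [mem_closedBall, dist_comm]
    linarith [hc j]
  · rw [mem_closedBall]
    calc dist (g (τ * j / m)) (⟨((c (j + 1)).1 : ℝ), ((c (j + 1)).2 : ℝ)⟩ : ℂ)
        ≤ dist (g (τ * j / m)) (g (τ * (j + 1 : ℕ) / m)) +
            dist (g (τ * (j + 1 : ℕ) / m)) (⟨((c (j + 1)).1 : ℝ), ((c (j + 1)).2 : ℝ)⟩ : ℂ) :=
          dist_triangle _ _ _
      _ ≤ δ / 4 + δ / 8 := by
          gcongr
          · exact (hcons j hj).le
          · have := hc (j + 1)
            rw [dist_comm] at this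
            push_cast at this ⊢
            exact this.le
      _ ≤ r := by linarith
  · refine Set.disjoint_left.2 fun u hu huK ↦ ?_
    rw [mem_closedBall] at hu
    have hj' : τ * j / m ∈ Icc 0 τ := hmem j ‹_›
    have h1 : δ ≤ dist (g (τ * j / m)) u := hdist _ hj' u huK
    have h2 : dist (g (τ * j / m)) u ≤ dist (g (τ * j / m)) (⟨((c j).1 : ℝ), ((c j).2 : ℝ)⟩ : ℂ)
        + dist (⟨((c j).1 : ℝ), ((c j).2 : ℝ)⟩ : ℂ) u := dist_triangle _ _ _
    have h3 : dist (g (τ * j / m)) (⟨((c j).1 : ℝ), ((c j).2 : ℝ)⟩ : ℂ) < δ / 8 := by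
      rw [dist_comm]; exact hc j
    rw [dist_comm] at hu
    linarith

end Chain

/-! ### The separation theorem -/

/-- **Anchored test sets separate points of `ℍ` from simple paths through `0`.** Let `K ∋ 0`
be a closed subset of `ℍ ∪ {0}` whose complement is connected (for the trace of a simple path
from `0` to `∞` in `ℍ ∪ {0}`: `isConnected_compl_image_of_tendsto_cocompact`, from the named
fact `JordanArcSeparation`),
and `z ∈ ℍ ∖ K`. Then some anchored test set contains `z` and misses `K`. [folklore] -/
theorem exists_anchored_testSet {K : Set ℂ} (hK : IsClosed K) (hKc : IsConnected Kᶜ)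
    (h0K : (0 : ℂ) ∈ K) (hKsub : K ⊆ upperHalfPlaneSet ∪ {0}) {z : ℂ} (hz : z ∈ upperHalfPlaneSet)
    (hzK : z ∉ K) :
    ∃ l : List (ℚ × ℚ × ℚ), IsAnchored (testSet l) ∧ z ∈ testSet l ∧ Disjoint (testSet l) K := by
  have hz0 : 0 < z.im := hz
  obtain ⟨g, hg, τ, hτ, hg0, hgτ, hgpos, hgK⟩ := exists_path_to_real hK hKc hKsub hz hzK
  obtain ⟨δ, hδ, hdist⟩ := exists_dist_le hK h0K hg hgK
  obtain ⟨m, c, r, hm0, hin, hnext, hdisj⟩ := exists_discChain hτ hg hδ hdist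
  -- the list of discs
  set l : List (ℚ × ℚ × ℚ) := (List.range (m + 1)).map fun j ↦ ((c j).1, (c j).2, r) with hl
  set B : ℕ → Set ℂ := fun j ↦ closedBall (⟨((c j).1 : ℝ), ((c j).2 : ℝ)⟩ : ℂ) r with hB
  have hmemL : ∀ {q : ℚ × ℚ × ℚ}, q ∈ l ↔ ∃ j, j ≤ m ∧ q = ((c j).1, (c j).2, r) := by
    intro q
    simp only [hl, List.mem_map, List.mem_range, Nat.lt_succ_iff]
    exact ⟨fun ⟨j, hj, hq⟩ ↦ ⟨j, hj, hq.symm⟩, fun ⟨j, hj, hq⟩ ↦ ⟨j, hj, hq.symm⟩⟩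
  have hTS : testSet l = (⋃ j ∈ Iic m, B j) ∩ {w : ℂ | 0 ≤ w.im} := by
    ext w
    simp only [testSet, mem_iUnion, mem_inter_iff, mem_Iic, exists_prop, halfDisc, mem_setOf_eq]
    constructor
    · rintro ⟨q, hq, hw, hwim⟩
      obtain ⟨j, hj, rfl⟩ := hmemL.1 hq
      exact ⟨⟨j, hj, hw⟩, hwim⟩
    · rintro ⟨⟨j, hj, hw⟩, hwim⟩
      exact ⟨((c j).1, (c j).2, r), hmemL.2 ⟨j, hj, rfl⟩, hw, hwim⟩
  have hmR : (0 : ℝ) < m := by exact_mod_cast hm0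
  have hgm : g (τ * m / m) = g τ := by rw [mul_div_assoc, div_self hmR.ne', mul_one]
  have hg0' : g (τ * (0 : ℕ) / m) = z := by simp [hg0]
  refine ⟨l, ⟨?_, ?_⟩, ?_, ?_⟩
  · -- `0 ∉ testSet l` since the discs miss `K ∋ 0`
    rw [hTS]
    rintro ⟨h0, -⟩
    simp only [mem_iUnion, mem_Iic, exists_prop] at h0
    obtain ⟨j, hj, h0j⟩ := h0
    exact Set.disjoint_left.1 (hdisj j hj) h0j h0K
  · -- `testSet l ∪ {Im ≤ 0}` is connected: a chain of discs ending on the real axis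
    have hchain : IsPreconnected (⋃ j ∈ Iic m, B j) := by
      refine IsPreconnected.biUnion_of_chain ordConnected_Iic (fun j _ ↦
        (convex_closedBall _ _).isPreconnected) fun j _ hj1 ↦ ?_
      rw [mem_Iic, Order.succ_eq_add_one] at hj1
      exact ⟨g (τ * j / m), hin j (by omega), hnext j (by omega)⟩
    have hx : g τ ∈ (⋃ j ∈ Iic m, B j) ∩ {w : ℂ | w.im ≤ 0} := by
      refine ⟨mem_iUnion₂.2 ⟨m, mem_Iic.2 le_rfl, ?_⟩, le_of_eq hgτ⟩
      have := hin m le_rfl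
      rwa [hgm] at this
    have hU : IsPreconnected ((⋃ j ∈ Iic m, B j) ∪ {w : ℂ | w.im ≤ 0}) :=
      hchain.union' ⟨g τ, hx⟩ (convex_halfSpace_im_le 0).isPreconnected
    have heq : testSet l ∪ {w : ℂ | w.im ≤ 0} = (⋃ j ∈ Iic m, B j) ∪ {w : ℂ | w.im ≤ 0} := by
      rw [hTS]
      ext w
      simp only [mem_union, mem_inter_iff, mem_setOf_eq]
      constructor
      · rintro (⟨h1, -⟩ | h2)
        · exact Or.inl h1
        · exact Or.inr h2
      · rintro (h1 | h2)
        · rcases le_or_gt 0 w.im with h | h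
          · exact Or.inl ⟨h1, h⟩
          · exact Or.inr h.le
        · exact Or.inr h2
    rw [heq]
    exact ⟨⟨g τ, Or.inr hx.2⟩, hU⟩
  · -- `z = g 0` is in the first disc
    rw [hTS]
    refine ⟨mem_iUnion₂.2 ⟨0, mem_Iic.2 (Nat.zero_le _), ?_⟩, hz0.le⟩
    have := hin 0 (Nat.zero_le _)
    rwa [hg0'] at this
  · rw [hTS]
    refine Set.disjoint_left.2 ?_
    rintro w ⟨hw, -⟩ hwK
    simp only [mem_iUnion, mem_Iic, exists_prop] at hw
    obtain ⟨j, hj, hwj⟩ := hw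
    exact Set.disjoint_left.1 (hdisj j hj) hwj hwK

end Literature.Probability.RandomPlanarGeometry

end
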